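import Summits.QuantumFields.YangMills.Theorems.UV3PinnedStepThroughOfMassEnvelope
import Summits.QuantumFields.YangMills.Theorems.AlphaInputsT3ACv3Histories
import Summits.QuantumFields.YangMills.Theorems.AlphaInputsT3ACv3SmallFactor
import HarnessLib

/-!
# R3 (cell `ym3-torus`, YM₃ on T³ — a ladder RUNG, NOT d = 4, NOT the Clay problem) — **R-19936-U OVER THE v3 SOCKET: THE ORGAN ROW `hlf` (the top-level large-field control,
# [Balaban1985UV3] (67)–(71) + [9] §3.C at `k = K`, for the WINDOWED PINNED WEIGHTS) IS A THEOREM MODULO hJ(v3) — THE TOP-LEVEL A.E. ENVELOPE OF THE PINNED TRANSPORTED MASSES**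

Seat `ym-ust-19936-w6` g7 (R526 (S) hand; LOCATE `LOCATE-S-ORGAN-w6g7.md` §3∕§4 «v3 is hJ's honest home»; ★★OWNER WORD 58 (e)).  THEOREMS ONLY (0 `def`, 0 `sorry`);
`--supports stmt-QuantumFields-19936 --as helper`; count-neutral; CONDITIONAL on the v3 (α) socket `AlphaInputsT3AC.OfV3At F 𝔠 a₀ a₁` and on hJ(v3).

THE CHAIN BY KERNEL AFTER THIS FILE (v3 currency — the U-face of record): `stub_unitEnvelope` (registered text) ⟸ ✓`UV3UnitEnvelopeFaceOfPackageV3.stub_unitEnvelope_of_packageV3_of_lfTop_ae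
(hpkg)(π)(hlf)` (px12 g13, p751000) ⟸ **`hlf` = §3 `AlphaInputsT3AC.OfV3At.hlf_ae_of_massEnvelope (hJ)`** — so R-19936-U over the v3 socket displays EXACTLY hJ(v3), with NO
trivial-history row: the v3 weights are `wtP = 𝟙[window]·massRecP ≤ massRecP` and `massRecP(triv) = 1` (`MassesPAC.massRecP_triv`; no floor, `∫ ≤ 1` uniformly).

hJ(v3) (display-grade; WORD 58 (a)(b)(d); (c) moot — `Family.b₀_sq_div`): `∃ A₁, ∀ K (r : Hist (F.P K) K), Admissible r → r ≠ triv → ∀ᵐ W ∂dV_K, M_K(r, W) ≤ exp A₁` for the PINNED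
masses `M = PinnedStep.massP 𝔠.lane (h.pkgAtV3 hc γ hγ hγ1 K).X = MassesPAC.massRecP …` (exact Radon–Nikodym transports of the step weights along `blockAvg ℰp`, trivial history
pinned to `1`).  WHY TRUE IN PRINT ∕ WHY OPEN HERE: print's masses are `≤ 1` by the Haar compatibility of its averaging; the tree's `blockAvg ℰp` is only absolutely continuous —
the k-fold Jacobian row (lit GAPS G-B10-10(c); LEAD ★w1 g11's K-21 reduces it to the measure inequality (a)′∀ on the partial iterates of Haar, here WITHOUT the v1 `(K+1)` floor factor).

CONTENTS (at `p : AlphaInputsT3AC.PkgAtV3 F 𝔠 γ hγ hγ1 K`; the v3 datum's `mainT`∕`Zterm` ARE the lane tower's `p.T.mainT`∕`p.T.Zterm`, its `LF K j W Φ = Σ_r p.wtP j r W·e^{Φ r}` by definition):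
§1 ★★ `smallFactorsAdm_towerOfAC_v3` (the admissible small-factors leaf for `towerOfAC` from the v3 rows, per plaquette ✓`AlphaV3AC.eq71_perPlaquette_of_alphaV3`) and ★
`Zterm_towerOfAC_top_le_booked` (booked Z-terms against the counted collars, generic over the AC inputs at the T³ scales); §2 ★★ `all_le_of_massEnvelope_v3` (FILE 1 ✓`largeField_enveloped_adm` (U) at the v3
package: `Σ_r wtP_K(r,W)·e^{−mainT+Zterm} ≤ e^{A}·e^{(6∕log L)(2L^m)³}` for a field `W` with `wtP_K(r,W) ≤ e^{A}` on admissible `r`); §3 ★★★ `AlphaInputsT3AC.OfV3At.hlf_ae_of_massEnvelope` — px12's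
✓p751000 per-package a.e. `hlf` binder from hJ(v3), `CZ := max A₁ 0 + (6∕log L)(2L^m)³`.

HONEST SCOPE.  Bookkeeping; hJ(v3) DISPLAYED, not proved; nothing of `stub_unitEnvelope`, `stub_pinnedStep`, `hP′`, `HistoryTailL` (19936), the rung, d = 4, a mass gap or Clay is
proved here; no summit statement is proved by this seat.

References: T. Bałaban, Commun. Math. Phys. **102** (1985) 255–275 [Balaban1985UV3] ((5) p. 256, (40)–(41) p. 266, (67)–(71) p. 273, pp. 273–274).
-/

set_option autoImplicit false

noncomputable section

namespace Summit.QuantumFields.YangMills.Theorems.UV3UnitEnvelopeOrganOfMassEnvelopeV3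

open MeasureTheory
open scoped BigOperators Matrix.Norms.L2Operator
open Literature.MathematicalPhysics.QuantumFieldTheory.Balaban1983to89
open Literature.MathematicalPhysics.QuantumFieldTheory.Balaban1983to89.B10LargeField (xlog one_le_xlog pFun_eq xlog_gRun)
open Literature.MathematicalPhysics.QuantumFieldTheory.Balaban1983to89.T3ContinuumYM3Torus
open Literature.MathematicalPhysics.QuantumFieldTheory.Balaban1983to89.T3UnitLawDensityEML (ℰp)
open Literature.MathematicalPhysics.QuantumFieldTheory.Balaban1985CMP102
open Literature.MathematicalPhysics.QuantumFieldTheory.Balaban1985CMP102.Setting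
open Summit.QuantumFields.Balaban3D.Carriers
open Summit.QuantumFields.Balaban3D.Proofs.Primitives
open Summit.QuantumFields.Balaban3D.Proofs.ScalesArithmetic (gk_pos gk_le_one g0sq_pos gk_eq_gRun_norm)
open Summit.QuantumFields.Balaban3D.Proofs.GroupModelLieC (lieC)
open Summit.QuantumFields.Balaban3D.Proofs.Family (prov_hb₁ prov_hb₂ prov_hp)
open Summit.QuantumFields.Balaban3D.Proofs.TowerAC
open Summit.QuantumFields.Balaban3D.Proofs.StandardAC
open Summit.QuantumFields.Balaban3D.Proofs.InputsAC
open Summit.QuantumFields.Balaban3D.Proofs.MassesPAC (massRecP_triv)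
open Summit.QuantumFields.Balaban3D.Proofs.AlphaAC (AlphaDataAC)
open Summit.QuantumFields.Balaban3D.Proofs.HistCount (card_filter_allCodes_le_exp)
open Summit.QuantumFields.Balaban3D.Proofs.Run3SmallFactors (regionT)
open Summit.QuantumFields.Balaban3D.Proofs.LargeFieldKnit (sum_sum_mem_le_mul_sum)
open Summit.QuantumFields.Balaban3D.Proofs.LargeFieldStd (rcolOf_antitone rcolOf_le zcoefOf_le zcoefOf_nonneg)
open Summit.QuantumFields.YangMills.Theorems.UV3LargeFieldEnvelopedResummation (largeField_enveloped_adm)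
open Summit.QuantumFields.YangMills.Theorems.UV3PinnedCollarBranch (zvol_real_le_sum)
open Summit.QuantumFields.YangMills.Theorems.UV3TowerOfACSmallFactorsAdm (card_filter_regionT_le_four')
open Summit.QuantumFields.YangMills.Theorems.AlphaV3AC

/-! ## §1 Lane-generic over the v3 rows: admissible small factors; booked Z-terms at the v3 package -/

section Lane

variable {L : ℕ} {S : Scales L} {G : Type} [GaugeGroup G] [MeasurableSpace G] [HaarData G] {𝔊 : GroupModel G} {𝔠 : AlphaConsts L 𝔊.N}
  {X : ExternalInputsAC S G} {𝔖 : ∀ k, StepSeries S G ↥(lieC 𝔊) (nblkOf S 𝔠.lane.carrier k) k} {𝔄 : AlphaDataAC 𝔊 𝔠 X 𝔖}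
  {win : (k : ℕ) → Hist S.P (k + 1) → Set (GaugeField S.P (k + 1) G)}
  (hle : S.g ^ 2 * S.ε₀ ≤ (min 𝔠.gamma0 1) ^ 2)
include hle

/-- ★★ **THE SMALL-FACTORS LEAF (67)–(71) ON ADMISSIBLE HISTORIES FOR THE AC TOWER `towerOfAC` OF A v3 PACKAGE** (twin of ✓`UV3TowerOfACSmallFactorsAdm.smallFactorsAdm_towerOfAC`
with the v3 rows, `c₁ = 1∕(4N)`): `adm h → (1∕(4N))·Σ_{e∈P(h)} p(g_{e.1})²∕4 ≤ mainT_k(h, U)` — per plaquette ✓`AlphaV3AC.eq71_perPlaquette_of_alphaV3`, globally the multiplicity `≤ 4` of the regions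
(`card_filter_regionT_le_four'`) and double counting (`LargeFieldKnit.sum_sum_mem_le_mul_sum`). [cite: Balaban1985UV3, (67)–(71) p.273] -/
theorem smallFactorsAdm_towerOfAC_v3 (hL : 2 ≤ L) (R : RunAlphaV3AC 𝔊 𝔠 X 𝔖 𝔄 win) :
    ∀ k, k ≤ S.K → ∀ (U : GaugeField S.P k G) (h : Hist S.P k),
      Hist.Admissible 𝔠.lane.carrier.M₁ (rcolOf S 𝔠.lane.carrier) k h →
        1 / (4 * (𝔊.N : ℝ)) * ∑ e ∈ Hist.disc h, B10.pFun 𝔠.lane.carrier.b₀ 𝔠.lane.carrier.p₀ (S.gk e.1) ^ 2 / 4 ≤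
          (towerOfAC 𝔠.lane X 𝔖).mainT k h U := by
  intro k hk U h hh
  classical
  have hkP : k ≤ S.P.m + S.P.K := by show k ≤ S.m + S.K; omega
  have hN : (0 : ℝ) < 𝔊.N := by exact_mod_cast 𝔊.N_pos
  set act : Plaq S.P 0 → ℝ := fun q => (S.eta k)⁻¹ * (1 - reTr (GaugeField.plaqHol (X.UkH k h U) q)) with hact
  have heta : 0 < S.eta k := by
    show 0 < ((S.P.L : ℝ)⁻¹) ^ k
    exact pow_pos (inv_pos.mpr (by exact_mod_cast S.P.L_pos)) k
  have hact0 : ∀ q, 0 ≤ act q := fun q =>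
    mul_nonneg (inv_nonneg.mpr heta.le) (sub_nonneg.mpr (GaugeGroup.reTr_le_one _))
  have hmain : (S.gk k)⁻¹ ^ 2 * ∑ q, act q = (towerOfAC 𝔠.lane X 𝔖).mainT k h U := rfl
  have h71 : ∀ e ∈ Hist.disc h, B10.pFun 𝔠.lane.carrier.b₀ 𝔠.lane.carrier.p₀ (S.gk e.1) ^ 2 / 4 ≤
      (𝔊.N : ℝ) * ((S.gk k)⁻¹ ^ 2 * ∑ q ∈ regionT (S := S) e, act q) :=
    fun e he => AlphaV3AC.eq71_perPlaquette_of_alphaV3 hle hL R k hk h hh U e he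
  have hsum : ∑ e ∈ Hist.disc h, B10.pFun 𝔠.lane.carrier.b₀ 𝔠.lane.carrier.p₀ (S.gk e.1) ^ 2 / 4 ≤
      (𝔊.N : ℝ) * ((S.gk k)⁻¹ ^ 2 * ∑ e ∈ Hist.disc h, ∑ q ∈ regionT (S := S) e, act q) := by
    calc ∑ e ∈ Hist.disc h, B10.pFun 𝔠.lane.carrier.b₀ 𝔠.lane.carrier.p₀ (S.gk e.1) ^ 2 / 4
        ≤ ∑ e ∈ Hist.disc h, (𝔊.N : ℝ) * ((S.gk k)⁻¹ ^ 2 * ∑ q ∈ regionT (S := S) e, act q) := Finset.sum_le_sum h71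
      _ = (𝔊.N : ℝ) * ((S.gk k)⁻¹ ^ 2 * ∑ e ∈ Hist.disc h, ∑ q ∈ regionT (S := S) e, act q) := by
          rw [Finset.mul_sum, Finset.mul_sum]
  have hdc : ∑ e ∈ Hist.disc h, ∑ q ∈ regionT (S := S) e, act q ≤ (4 : ℕ) * ∑ q, act q :=
    sum_sum_mem_le_mul_sum (Hist.disc h) Finset.univ (regionT (S := S)) act (fun q _ => hact0 q)
      (fun _ _ => Finset.subset_univ _) 4 (fun q _ => card_filter_regionT_le_four' _ _ hkP hh q)
  have hg0 : 0 ≤ (S.gk k)⁻¹ ^ 2 := sq_nonneg _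
  calc 1 / (4 * (𝔊.N : ℝ)) * ∑ e ∈ Hist.disc h, B10.pFun 𝔠.lane.carrier.b₀ 𝔠.lane.carrier.p₀ (S.gk e.1) ^ 2 / 4
      ≤ 1 / (4 * (𝔊.N : ℝ)) * ((𝔊.N : ℝ) * ((S.gk k)⁻¹ ^ 2 * ((4 : ℕ) * ∑ q, act q))) := by
        refine mul_le_mul_of_nonneg_left (hsum.trans ?_) (by positivity)
        exact mul_le_mul_of_nonneg_left (mul_le_mul_of_nonneg_left hdc hg0) hN.le
    _ = (S.gk k)⁻¹ ^ 2 * ∑ q, act q := by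
        push_cast
        field_simp
    _ = (towerOfAC 𝔠.lane X 𝔖).mainT k h U := hmain


end Lane

variable {F : T3Family} {𝔠 : AlphaConsts F.L (suGroupModel 2).N} {γ : ℝ} {hγ : 0 < γ} {hγ1 : γ ≤ (min 𝔠.gamma0 1) ^ 2} {K : ℕ}
  (p : AlphaInputsT3AC.PkgAtV3 F 𝔠 γ hγ hγ1 K)

/-- **`Zterm_K(r) ≤ Σ_{i<K} A·x(g_i)·zvol_i(P(r))`** at the unit lattice, for ANY AC inputs `X, 𝔖` at the T³ scales (generic twin of ✓`UV3PinnedStepThroughOfMassEnvelope.Zterm_top_le_booked`): the tower's booked Z-terms `Σ_{i<K} CZ_i·|Z_i(r)|` (`towerOfAC`, by `rfl`) with `CZ_i ≤ A·x(g_i)` (`LargeFieldStd.zcoefOf_le`,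
`A = (Cz+Cv)+C₅+C₆+(|logσ₀|+dg)c₁`) and the collar count `|Z_i(r)| ≤ Σ_{(i′,p′)∈P(r), i′≤i} (K_c·x(g_{i′})^{r₀})³` (FILE 2 ✓`zvol_real_le_sum`, `K_c = 2(2(R₁+1)M₁ + 2B + 20)`).
[cite: Balaban1985UV3, (39) p.266, (41) p.266] -/
theorem Zterm_towerOfAC_top_le_booked
    (X : ExternalInputsAC (T3Scales F γ hγ (hγ1.trans (sq_min_one_le _ 𝔠.gamma0_pos)) K) (Matrix.specialUnitaryGroup (Fin 2) ℂ))
    (𝔖 : ∀ k, StepSeries (T3Scales F γ hγ (hγ1.trans (sq_min_one_le _ 𝔠.gamma0_pos)) K) (Matrix.specialUnitaryGroup (Fin 2) ℂ)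
      ↥(lieC (suGroupModel 2)) (nblkOf (T3Scales F γ hγ (hγ1.trans (sq_min_one_le _ 𝔠.gamma0_pos)) K) 𝔠.lane.carrier k) k)
    (r : Hist (F.P K) K) :
    (towerOfAC 𝔠.lane X 𝔖).Zterm K r ≤ ∑ i ∈ Finset.range K,
      ((𝔠.lane.carrier.Cz + 𝔠.lane.carrier.Cv) + 𝔠.lane.carrier.C₅ + 𝔠.lane.carrier.C₆ +
          (|𝔠.lane.carrier.logσ₀| + 𝔠.lane.carrier.dg) * 𝔠.lane.carrier.c₁) *
        xlog ((T3Scales F γ hγ (hγ1.trans (sq_min_one_le _ 𝔠.gamma0_pos)) K).gk i) *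
        ∑ e ∈ (Hist.disc r).filter (fun e => e.1 ≤ i),
          (2 * (2 * ((𝔠.lane.carrier.R₁ + 1) * 𝔠.lane.carrier.M₁) + 2 * ((F.L : ℝ) * (3 * ((𝔠.lane.carrier.M₁ : ℝ) - 1)) + 3 * ((F.L : ℝ) - 1)) + 20) * 1) ^ 3 *
            xlog ((T3Scales F γ hγ (hγ1.trans (sq_min_one_le _ 𝔠.gamma0_pos)) K).gk e.1) ^ (3 * 𝔠.lane.carrier.r₀) := by
  have hSK : (T3Scales F γ hγ (hγ1.trans (sq_min_one_le _ 𝔠.gamma0_pos)) K).K = K := rfl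
  have hL : 2 ≤ F.L := F.hL.2
  have hR₁ : 0 ≤ 𝔠.lane.carrier.R₁ := 𝔠.R₁_nonneg
  have hr : 0 ≤ 𝔠.lane.carrier.r₀ := le_trans zero_le_one 𝔠.one_le_r₀
  have hM : 0 < 𝔠.lane.carrier.M₁ := 𝔠.lane.F.M₁_pos
  have hCz : 0 ≤ 𝔠.lane.carrier.Cz + 𝔠.lane.carrier.Cv := add_nonneg 𝔠.Cz_nonneg 𝔠.Cv_nonneg
  have h5 : 0 ≤ 𝔠.lane.carrier.C₅ := 𝔠.C₅_nonneg
  have h6 : 0 ≤ 𝔠.lane.carrier.C₆ := 𝔠.C₆_nonneg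
  have hc₁ : 0 ≤ 𝔠.lane.carrier.c₁ := by show (0 : ℝ) ≤ 3; norm_num
  have hg : ∀ i, i ≤ (T3Scales F γ hγ (hγ1.trans (sq_min_one_le _ 𝔠.gamma0_pos)) K).K → 0 < (T3Scales F γ hγ (hγ1.trans (sq_min_one_le _ 𝔠.gamma0_pos)) K).gk i ∧ (T3Scales F γ hγ (hγ1.trans (sq_min_one_le _ 𝔠.gamma0_pos)) K).gk i ≤ 1 := fun i hi => ⟨gk_pos (T3Scales F γ hγ (hγ1.trans (sq_min_one_le _ 𝔠.gamma0_pos)) K) i, gk_le_one (T3Scales F γ hγ (hγ1.trans (sq_min_one_le _ 𝔠.gamma0_pos)) K) (T3Scales F γ hγ (hγ1.trans (sq_min_one_le _ 𝔠.gamma0_pos)) K).gK_le_one i hi⟩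
  have hZ : (towerOfAC 𝔠.lane X 𝔖).Zterm K r = ∑ i ∈ Finset.range K,
      zcoefOf (T3Scales F γ hγ (hγ1.trans (sq_min_one_le _ 𝔠.gamma0_pos)) K) 𝔠.lane.carrier i * (ZVol 𝔠.lane.carrier.M₁ (rcolOf (T3Scales F γ hγ (hγ1.trans (sq_min_one_le _ 𝔠.gamma0_pos)) K) 𝔠.lane.carrier) K r i : ℝ) := rfl
  rw [hZ]
  refine Finset.sum_le_sum fun i hi => ?_
  rw [Finset.mem_range] at hi
  have hiK : i < (T3Scales F γ hγ (hγ1.trans (sq_min_one_le _ 𝔠.gamma0_pos)) K).K := by rw [hSK]; exact hi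
  have hz := zcoefOf_le (S := (T3Scales F γ hγ (hγ1.trans (sq_min_one_le _ 𝔠.gamma0_pos)) K)) 𝔠.lane.carrier hCz h5 h6 hc₁ i hiK
  have hz0 := zcoefOf_nonneg (S := (T3Scales F γ hγ (hγ1.trans (sq_min_one_le _ 𝔠.gamma0_pos)) K)) 𝔠.lane.carrier hCz h5 h6 hc₁ i hiK
  have hcol := zvol_real_le_sum (S := (T3Scales F γ hγ (hγ1.trans (sq_min_one_le _ 𝔠.gamma0_pos)) K)) 𝔠.lane.carrier.M₁ (rcolOf (T3Scales F γ hγ (hγ1.trans (sq_min_one_le _ 𝔠.gamma0_pos)) K) 𝔠.lane.carrier) hM (rcolOf_antitone (S := (T3Scales F γ hγ (hγ1.trans (sq_min_one_le _ 𝔠.gamma0_pos)) K)) 𝔠.lane.carrier hR₁ hr)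
    hL (ρ' := (𝔠.lane.carrier.R₁ + 1) * 𝔠.lane.carrier.M₁) (by positivity) hr (rcolOf_le (S := (T3Scales F γ hγ (hγ1.trans (sq_min_one_le _ 𝔠.gamma0_pos)) K)) 𝔠.lane.carrier hR₁ hr) hg
    K le_rfl r i hi
  have hV0 : (0 : ℝ) ≤ (ZVol 𝔠.lane.carrier.M₁ (rcolOf (T3Scales F γ hγ (hγ1.trans (sq_min_one_le _ 𝔠.gamma0_pos)) K) 𝔠.lane.carrier) K r i : ℝ) := Nat.cast_nonneg _
  calc zcoefOf (T3Scales F γ hγ (hγ1.trans (sq_min_one_le _ 𝔠.gamma0_pos)) K) 𝔠.lane.carrier i * (ZVol 𝔠.lane.carrier.M₁ (rcolOf (T3Scales F γ hγ (hγ1.trans (sq_min_one_le _ 𝔠.gamma0_pos)) K) 𝔠.lane.carrier) K r i : ℝ)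
      ≤ (((𝔠.lane.carrier.Cz + 𝔠.lane.carrier.Cv) + 𝔠.lane.carrier.C₅ + 𝔠.lane.carrier.C₆ +
          (|𝔠.lane.carrier.logσ₀| + 𝔠.lane.carrier.dg) * 𝔠.lane.carrier.c₁) * xlog ((T3Scales F γ hγ (hγ1.trans (sq_min_one_le _ 𝔠.gamma0_pos)) K).gk i)) *
          (ZVol 𝔠.lane.carrier.M₁ (rcolOf (T3Scales F γ hγ (hγ1.trans (sq_min_one_le _ 𝔠.gamma0_pos)) K) 𝔠.lane.carrier) K r i : ℝ) := mul_le_mul_of_nonneg_right hz hV0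
    _ ≤ _ := mul_le_mul_of_nonneg_left hcol (hz0.trans hz)



/-! ## §2 The un-pinned (41)_K sum of the windowed pinned weights under the envelope -/

/-- ★★ **THE UN-PINNED (41)_K HISTORY SUM UNDER A MASS ENVELOPE ON ALL ADMISSIBLE HISTORIES** — FILE 1 ✓`largeField_enveloped_adm` (U) at the v3 package (twin of ✓`UV3UnitEnvelopeOrganOfMassEnvelope.all_le_of_massEnvelope`
with the windowed pinned weights `wtP` and the v3 rows, `H := univ`): `Σ_r m_K(r,W)·e^{−mainT_K(r,W) + Zterm_K(r)} ≤ e^{A}·e^{(3∕ℓ)(2L^m)³}`, `ℓ = ½ log L`. [cite: Balaban1985UV3, (41) p.266, (67)–(71) p.273, pp.273–274] -/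
theorem all_le_of_massEnvelope_v3 {A : ℝ} (W : GaugeField (F.P K) K (Matrix.specialUnitaryGroup (Fin 2) ℂ))
    (hW : ∀ r : Hist (F.P K) K,
      Hist.Admissible 𝔠.lane.carrier.M₁ (rcolOf (T3Scales F γ hγ (hγ1.trans (sq_min_one_le _ 𝔠.gamma0_pos)) K) 𝔠.lane.carrier) K r →
      p.wtP K r W ≤ Real.exp A) :
    ∑ r : Hist (F.P K) K,
        p.wtP K r W * Real.exp (-(p.T.mainT K r W) + p.T.Zterm K r)
      ≤ Real.exp A * Real.exp (3 / (Real.log F.L / 2) * (2 * (F.L : ℝ) ^ F.m) ^ 3) := by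
  classical
  set S := T3Scales F γ hγ (hγ1.trans (sq_min_one_le _ 𝔠.gamma0_pos)) K with hS
  have hSK : S.K = K := rfl
  have hL : 2 ≤ F.L := F.hL.2
  have hLr : (2 : ℝ) ≤ F.L := by exact_mod_cast hL
  have hR₁ : 0 ≤ 𝔠.lane.carrier.R₁ := 𝔠.R₁_nonneg
  have hr : 0 ≤ 𝔠.lane.carrier.r₀ := le_trans zero_le_one 𝔠.one_le_r₀
  have hM : 0 < 𝔠.lane.carrier.M₁ := 𝔠.lane.F.M₁_pos
  have hCz : 0 ≤ 𝔠.lane.carrier.Cz + 𝔠.lane.carrier.Cv := add_nonneg 𝔠.Cz_nonneg 𝔠.Cv_nonneg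
  have h5 : 0 ≤ 𝔠.lane.carrier.C₅ := 𝔠.C₅_nonneg
  have h6 : 0 ≤ 𝔠.lane.carrier.C₆ := 𝔠.C₆_nonneg
  have hc₁ : 0 ≤ 𝔠.lane.carrier.c₁ := by show (0 : ℝ) ≤ 3; norm_num
  have hNpos : 0 < (suGroupModel 2).N := (suGroupModel 2).N_pos
  have hg : ∀ i, i ≤ K → 0 < S.gk i ∧ S.gk i ≤ 1 := fun i hi => ⟨gk_pos S i, gk_le_one S S.gK_le_one i hi⟩
  have hlogL : 0 < Real.log F.L := Real.log_pos (by linarith)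
  have hℓ : 0 < Real.log (F.L : ℝ) / 2 := by positivity
  -- the site count at the unit lattice
  have hsites : (Fintype.card (Site (F.P K) K) : ℝ) = (2 * (F.L : ℝ) ^ F.m) ^ 3 := by
    rw [Site.card_site]
    have : (F.P K).sitesPerDir K = 2 * F.L ^ F.m := by simp [Params.sitesPerDir]
    rw [this]
    push_cast
    rfl
  -- the progression of the couplings
  have hx : ∀ i, i ≤ K → xlog (S.gk i) = xlog (S.gk K) + ((K - i : ℕ) : ℝ) * (Real.log F.L / 2) := by
    intro i hi
    rw [gk_eq_gRun_norm S i, gk_eq_gRun_norm S K]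
    exact xlog_gRun 1 (F.L : ℝ) S.g0sq one_pos (by linarith) (g0sq_pos S) hi
  -- the sign of `A` and the provisos
  have hA : 0 ≤ (𝔠.lane.carrier.Cz + 𝔠.lane.carrier.Cv) + 𝔠.lane.carrier.C₅ + 𝔠.lane.carrier.C₆ +
      (|𝔠.lane.carrier.logσ₀| + 𝔠.lane.carrier.dg) * 𝔠.lane.carrier.c₁ := by
    have := 𝔠.lane.carrier.dg_nonneg
    have := abs_nonneg 𝔠.lane.carrier.logσ₀
    positivity
  have hp := prov_hp 𝔠
  have hb₁ := prov_hb₁ 𝔠 hNpos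
  have hb₂ := prov_hb₂ 𝔠 hNpos
  have hcL : 𝔠.lane.consts.L = (F.L : ℝ) := rfl
  rw [hcL] at hb₁
  have hMr : (1 : ℝ) ≤ 𝔠.lane.carrier.M₁ := by exact_mod_cast hM
  have hcg : (0 : ℝ) ≤ (2 * (2 * ((𝔠.lane.carrier.R₁ + 1) * 𝔠.lane.carrier.M₁) +
      2 * ((F.L : ℝ) * (3 * ((𝔠.lane.carrier.M₁ : ℝ) - 1)) + 3 * ((F.L : ℝ) - 1)) + 20)) * 1 := by
    have h1 : (0 : ℝ) ≤ (𝔠.lane.carrier.R₁ + 1) * 𝔠.lane.carrier.M₁ := by positivity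
    have h2 : (0 : ℝ) ≤ (F.L : ℝ) * (3 * ((𝔠.lane.carrier.M₁ : ℝ) - 1)) := by nlinarith
    nlinarith
  refine (largeField_enveloped_adm (k := K) (K := K) le_rfl S.gk (b₀ := 𝔠.lane.carrier.b₀) (p₀ := 𝔠.lane.carrier.p₀)
    (A := (𝔠.lane.carrier.Cz + 𝔠.lane.carrier.Cv) + 𝔠.lane.carrier.C₅ + 𝔠.lane.carrier.C₆ +
      (|𝔠.lane.carrier.logσ₀| + 𝔠.lane.carrier.dg) * 𝔠.lane.carrier.c₁) (A₀ := 0)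
    (c₁ := 1 / (4 * ((suGroupModel 2).N : ℝ))) (gs := 1)
    (cg := 2 * (2 * ((𝔠.lane.carrier.R₁ + 1) * 𝔠.lane.carrier.M₁) + 2 * ((F.L : ℝ) * (3 * ((𝔠.lane.carrier.M₁ : ℝ) - 1)) + 3 * ((F.L : ℝ) - 1)) + 20))
    (ρ := 1) (r₀ := 𝔠.lane.carrier.r₀) (ℓ := Real.log F.L / 2) (xK := xlog (S.gk K)) (S := (2 * (F.L : ℝ) ^ F.m) ^ 3)
    (σ := 3 * Real.log F.L) (Menv := Real.exp A)
    (allCodes (F.P K) K) (fun e he => Hist.disc_lt _ e he) ?cardE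
    (Finset.univ : Finset (Hist (F.P K) K))
    (Hist.Admissible 𝔠.lane.carrier.M₁ (rcolOf S 𝔠.lane.carrier) K) Hist.disc
    (fun r _ _ => Hist.disc_subset_allCodes r) ((Hist.disc_injective K).injOn.mono (Set.subset_univ _))
    (fun r => p.wtP K r W) (fun r => p.T.mainT K r W) (fun r => p.T.Zterm K r)
    (fun i Q => ∑ e ∈ Q.filter (fun e => e.1 ≤ i),
      (2 * (2 * ((𝔠.lane.carrier.R₁ + 1) * 𝔠.lane.carrier.M₁) + 2 * ((F.L : ℝ) * (3 * ((𝔠.lane.carrier.M₁ : ℝ) - 1)) + 3 * ((F.L : ℝ) - 1)) + 20) * 1) ^ 3 *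
        xlog (S.gk e.1) ^ (3 * 𝔠.lane.carrier.r₀))
    (Real.exp_pos _).le ?madm ?menv ?sf ?zt (fun Q _ i _ => le_rfl)
    hA le_rfl (by positivity) hcg hr hℓ (by positivity) hg le_rfl hx hp ?b1 ?b2).1
  case cardE =>
    intro i hi
    have h := card_filter_allCodes_le_exp (P := F.P K) rfl hi (by show K ≤ F.m + K; omega)
    rw [hsites] at h
    exact h
  case madm =>
    intro r _ hna
    exact PinnedStep.wtP_eq_zero_of_not_admissible 𝔠.lane p.X (AlphaInputsT3AC.admWindowT3 F 𝔠 γ hγ hγ1 K) K r W hna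
  case menv =>
    intro r _ hadm
    rw [zero_mul, Real.exp_zero, mul_one]
    exact hW r hadm
  case sf =>
    intro r _ hadm
    exact smallFactorsAdm_towerOfAC_v3 (T3Scales_window F 𝔠 γ hγ hγ1 K) hL p.run K le_rfl W r hadm
  case zt =>
    intro r _ _
    exact Zterm_towerOfAC_top_le_booked (hγ1 := hγ1) p.X p.𝔖 r
  case b1 =>
    simpa using hb₁
  case b2 =>
    nlinarith [hb₂, hlogL]

/-! ## §3 The `hlf` row of record (v3) from hJ(v3) -/

/-- ★★★ **THE ORGAN ROW `hlf` OF R-19936-U OVER THE v3 SOCKET (✓`UV3UnitEnvelopeFaceOfPackageV3.stub_unitEnvelope_of_packageV3_of_lfTop_ae`'s per-package a.e. binder)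
FROM hJ(v3).**  Per run the finitely many a.e. envelopes of the PINNED masses `massP` are gathered (`ae_all_iff`); the windowed weights satisfy `wtP ≤ massP` (`PinnedStep.wtP_nonneg_le`) and
`massP(triv) = 1` (`MassesPAC.massRecP_triv`), so EVERY admissible history has `wtP_K(r, W) ≤ exp(max A₁ 0)`; then §2.  `CZ := max A₁ 0 + (6∕log L)(2L^m)³`.  With px12's face: `stub_unitEnvelope`
⟸ v3 socket + hJ(v3) — no `hMain`, no trivial-history row. [cite: Balaban1985UV3, (5) p.256, (40)–(41) p.266, (67)–(71) p.273, pp.273–274] -/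
theorem _root_.Summit.QuantumFields.YangMills.Theorems.AlphaInputsT3AC.OfV3At.hlf_ae_of_massEnvelope {a₀ a₁ : ℝ} (h : AlphaInputsT3AC.OfV3At F 𝔠 a₀ a₁)
    (hc : 0 < a₀ ∧ 0 < a₁ ∧ 𝔠.B₃ * a₁ ≤ a₀) (γ : ℝ) (hγ : 0 < γ) (hγ1 : γ ≤ (min 𝔠.gamma0 1) ^ 2) (π : AlphaInputsT3AC.PolymerT3 F)
    (hJ : ∃ A₁ : ℝ, ∀ (K : ℕ) (r : Hist (F.P K) K),
      Hist.Admissible 𝔠.lane.carrier.M₁ (rcolOf (T3Scales F γ hγ (hγ1.trans (sq_min_one_le _ 𝔠.gamma0_pos)) K) 𝔠.lane.carrier) K r →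
      r ≠ Hist.triv (F.P K) K →
      ∀ᵐ W ∂(fieldMeasure (F.P K) K (Matrix.specialUnitaryGroup (Fin 2) ℂ)),
        PinnedStep.massP 𝔠.lane (h.pkgAtV3 hc γ hγ hγ1 K).X K r W ≤ Real.exp A₁) :
    ∃ CZ : ℝ, ∀ (K : ℕ), 1 ≤ K → ∀ᵐ W ∂fieldMeasure (F.P K) K (Matrix.specialUnitaryGroup (Fin 2) ℂ),
      (h.dataT3v3 hc γ hγ hγ1 π).LF K K W
          (fun r => -((h.dataT3v3 hc γ hγ hγ1 π).mainT K K r W) + (h.dataT3v3 hc γ hγ hγ1 π).Zterm K K r) ≤ Real.exp CZ := by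
  obtain ⟨A₁, hA₁⟩ := hJ
  refine ⟨max A₁ 0 + 3 / (Real.log F.L / 2) * (2 * (F.L : ℝ) ^ F.m) ^ 3, fun K _ => ?_⟩
  have hae : ∀ᵐ W ∂(fieldMeasure (F.P K) K (Matrix.specialUnitaryGroup (Fin 2) ℂ)), ∀ r : Hist (F.P K) K,
      Hist.Admissible 𝔠.lane.carrier.M₁ (rcolOf (T3Scales F γ hγ (hγ1.trans (sq_min_one_le _ 𝔠.gamma0_pos)) K) 𝔠.lane.carrier) K r →
      (h.pkgAtV3 hc γ hγ hγ1 K).wtP K r W ≤ Real.exp (max A₁ 0) := by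
    refine ae_all_iff.2 fun r => ?_
    have hwt : ∀ W, (h.pkgAtV3 hc γ hγ hγ1 K).wtP K r W ≤ PinnedStep.massP 𝔠.lane (h.pkgAtV3 hc γ hγ hγ1 K).X K r W := fun W =>
      (PinnedStep.wtP_nonneg_le 𝔠.lane (h.pkgAtV3 hc γ hγ hγ1 K).X (AlphaInputsT3AC.admWindowT3 F 𝔠 γ hγ hγ1 K) K r W).2
    by_cases hadm : Hist.Admissible 𝔠.lane.carrier.M₁
      (rcolOf (T3Scales F γ hγ (hγ1.trans (sq_min_one_le _ 𝔠.gamma0_pos)) K) 𝔠.lane.carrier) K r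
    · by_cases hne : r = Hist.triv (F.P K) K
      · subst hne
        refine Filter.Eventually.of_forall fun W _ => (hwt W).trans ?_
        rw [show PinnedStep.massP 𝔠.lane (h.pkgAtV3 hc γ hγ hγ1 K).X K (Hist.triv (F.P K) K) W = 1 from massRecP_triv _ _ _ _ _ K W]
        exact Real.one_le_exp (le_max_right _ _)
      · filter_upwards [hA₁ K r hadm hne] with W hW
        exact fun _ => ((hwt W).trans hW).trans (Real.exp_le_exp.mpr (le_max_left _ _))
    · exact Filter.Eventually.of_forall fun W h1 => absurd h1 hadm
  filter_upwards [hae] with W hW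
  rw [Real.exp_add]
  exact all_le_of_massEnvelope_v3 (h.pkgAtV3 hc γ hγ hγ1 K) W hW

end Summit.QuantumFields.YangMills.Theorems.UV3UnitEnvelopeOrganOfMassEnvelopeV3

end
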